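import Mathlib
import HarnessLib

/-!
# Crux `SplitBlockJacobiCorner` (stmt-Parity-15002, route `IsogenyRedei`), line `Sketch`:
# the Gauss-coordinate split of the root phase (`stub_gaussCoordinateSplit`, T0)

For `a : ℤ`, `0 < b`, `0 < n`, `Q = a² + b²`, `gcd(b, a·n) = 1`, `gcd(n, Q) = 1`, with the least
non-negative residues `ν := a·b⁻¹ (mod Q)`, `n̄ := n⁻¹ (mod Q)`, `u := (a n)⁻¹ (mod b)`,
`v := (b Q)⁻¹ (mod n)`:

  `e(h ν n̄ / Q) = e(−h u / b) · e(−h a v / n) · e(h a / (b n Q))`,   `e(r) = exp(2π i r)`.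

Proof.  All four phases are `e` of rationals, so it suffices that the exponents differ by an
integer, i.e. that `W := b n ν n̄ + n Q u + a b Q v − a` is divisible by `b n Q`.  The three moduli
are pairwise coprime (`gcd(b, Q) = gcd(b, a²) = 1`), and `W ≡ 0` modulo each of them:
mod `Q` because `b ν ≡ a` and `n n̄ ≡ 1`; mod `b` because `Q ≡ a²` and `(a n) u ≡ 1`;
mod `n` because `(b Q) v ≡ 1`.  Degenerate moduli (`b = 1`, `n = 1`, `Q = 1`) need no special
treatment: `ZMod 1` is the zero ring, where every congruence holds.

Mathlib only (`ZMod`, `IsCoprime`, `Complex.exp_eq_exp_iff_exists_int`); nothing is cited.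
-/

noncomputable section

namespace Summit.Parity.BatemanHorn.Cruxes.SplitBlockJacobiCorner.Sketch

/-- Congruence modulo `Q`: if `b` and `n` are units modulo `Q`, then with the least residues
`ν = (a b⁻¹ mod Q)` and `n̄ = (n⁻¹ mod Q)` one has `Q ∣ b n ν n̄ − a`. [folklore] -/
theorem gaussSplit_dvd_modQ (a : ℤ) (b Q n : ℕ) (hQ : 0 < Q) (hbQ : Nat.Coprime b Q)
    (hnQ : Nat.Coprime n Q) :
    (Q : ℤ) ∣ (b : ℤ) * n * ((((a : ZMod Q) * ((b : ZMod Q))⁻¹).val : ℕ) : ℤ) *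
        ((((n : ZMod Q))⁻¹.val : ℕ) : ℤ) - a := by
  haveI : NeZero Q := ⟨hQ.ne'⟩
  rw [← ZMod.intCast_zmod_eq_zero_iff_dvd]
  push_cast
  rw [ZMod.natCast_zmod_val, ZMod.natCast_zmod_val]
  have h1 : (b : ZMod Q) * (b : ZMod Q)⁻¹ = 1 := ZMod.coe_mul_inv_eq_one _ hbQ
  have h2 : (n : ZMod Q) * (n : ZMod Q)⁻¹ = 1 := ZMod.coe_mul_inv_eq_one _ hnQ
  linear_combination ((a : ZMod Q) * ((n : ZMod Q) * (n : ZMod Q)⁻¹)) * h1 + (a : ZMod Q) * h2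

/-- Congruence modulo `b`: if `Q ≡ a² (mod b)` and `a n` is a unit modulo `b`, then with the least
residue `u = ((a n)⁻¹ mod b)` one has `b ∣ n Q u − a`. [folklore] -/
theorem gaussSplit_dvd_modb (a : ℤ) (b Q n : ℕ) (hb : 0 < b) (hQ : (Q : ℤ) = a ^ 2 + (b : ℤ) ^ 2)
    (hcop : IsCoprime (b : ℤ) (a * n)) :
    (b : ℤ) ∣ (n : ℤ) * Q * (((((a * n : ℤ) : ZMod b))⁻¹.val : ℕ) : ℤ) - a := by
  haveI : NeZero b := ⟨hb.ne'⟩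
  have hu : ((a * n : ℤ) : ZMod b) * (((a * n : ℤ) : ZMod b))⁻¹ = 1 :=
    ZMod.mul_inv_of_unit _ ((ZMod.coe_int_isUnit_iff_isCoprime _ _).2 hcop)
  have hQb : ((Q : ℤ) : ZMod b) = (a : ZMod b) ^ 2 := by
    rw [hQ]; push_cast; rw [ZMod.natCast_self]; ring
  rw [← ZMod.intCast_zmod_eq_zero_iff_dvd]
  push_cast
  rw [ZMod.natCast_zmod_val]
  push_cast at hu hQb
  rw [hQb]
  linear_combination (a : ZMod b) * hu

/-- Congruence modulo `n`: if `b Q` is a unit modulo `n`, then with the least residue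
`v = ((b Q)⁻¹ mod n)` one has `n ∣ a b Q v − a`. [folklore] -/
theorem gaussSplit_dvd_modn (a : ℤ) (b Q n : ℕ) (hn : 0 < n) (hcop : Nat.Coprime (b * Q) n) :
    (n : ℤ) ∣ a * b * Q * (((((b * Q : ℕ) : ZMod n))⁻¹.val : ℕ) : ℤ) - a := by
  haveI : NeZero n := ⟨hn.ne'⟩
  have hv : ((b * Q : ℕ) : ZMod n) * (((b * Q : ℕ) : ZMod n))⁻¹ = 1 :=
    ZMod.coe_mul_inv_eq_one _ hcop
  rw [← ZMod.intCast_zmod_eq_zero_iff_dvd]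
  push_cast
  rw [ZMod.natCast_zmod_val]
  push_cast at hv
  linear_combination (a : ZMod n) * hv

/-- The combined divisibility `b n Q ∣ W`, `W := b n ν n̄ + n Q u + a b Q v − a`, from the three
congruences and the pairwise coprimality of `b, n, Q`. [folklore] -/
theorem gaussSplit_dvd (a : ℤ) (b Q n : ℕ) (hb : 0 < b) (hn : 0 < n)
    (hQ : (Q : ℤ) = a ^ 2 + (b : ℤ) ^ 2) (hcop : Int.gcd (b : ℤ) (a * n) = 1)
    (hnQ : Nat.Coprime n Q) :
    ((b : ℤ) * n * Q) ∣
      (b : ℤ) * n * ((((a : ZMod Q) * ((b : ZMod Q))⁻¹).val : ℕ) : ℤ) *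
            ((((n : ZMod Q))⁻¹.val : ℕ) : ℤ) +
          (n : ℤ) * Q * (((((a * n : ℤ) : ZMod b))⁻¹.val : ℕ) : ℤ) +
          a * b * Q * (((((b * Q : ℕ) : ZMod n))⁻¹.val : ℕ) : ℤ) - a := by
  have hcopI : IsCoprime (b : ℤ) (a * n) := Int.isCoprime_iff_gcd_eq_one.2 hcop
  have hba : IsCoprime (b : ℤ) a := hcopI.of_mul_right_left
  have hbn : IsCoprime (b : ℤ) (n : ℤ) := hcopI.of_mul_right_right
  have hbQ : IsCoprime (b : ℤ) (Q : ℤ) := by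
    rw [hQ, sq (b : ℤ)]
    exact (IsCoprime.pow_right (n := 2) hba).add_mul_left_right (b : ℤ)
  have hnQI : IsCoprime (n : ℤ) (Q : ℤ) := Nat.isCoprime_iff_coprime.2 hnQ
  have hQpos : 0 < Q := by
    have : (0 : ℤ) < Q := by rw [hQ]; have := hb; positivity
    exact_mod_cast this
  have dQ := gaussSplit_dvd_modQ a b Q n hQpos (Nat.isCoprime_iff_coprime.1 hbQ) hnQ
  have db := gaussSplit_dvd_modb a b Q n hb hQ hcopI
  have dn := gaussSplit_dvd_modn a b Q n hn
    (Nat.Coprime.mul_left (Nat.isCoprime_iff_coprime.1 hbn) hnQ.symm)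
  generalize ((((a : ZMod Q) * ((b : ZMod Q))⁻¹).val : ℕ) : ℤ) = ν at dQ ⊢
  generalize ((((n : ZMod Q))⁻¹.val : ℕ) : ℤ) = nb at dQ ⊢
  generalize (((((a * n : ℤ) : ZMod b))⁻¹.val : ℕ) : ℤ) = u at db ⊢
  generalize (((((b * Q : ℕ) : ZMod n))⁻¹.val : ℕ) : ℤ) = v at dn ⊢
  refine IsCoprime.mul_dvd (IsCoprime.mul_left hbQ hnQI) (IsCoprime.mul_dvd hbn ?_ ?_) ?_
  · have e : (b : ℤ) * n * ν * nb + n * Q * u + a * b * Q * v - a =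
        (n * Q * u - a) + b * (n * ν * nb + a * Q * v) := by ring
    rw [e]; exact dvd_add db (dvd_mul_right _ _)
  · have e : (b : ℤ) * n * ν * nb + n * Q * u + a * b * Q * v - a =
        (a * b * Q * v - a) + n * (b * ν * nb + Q * u) := by ring
    rw [e]; exact dvd_add dn (dvd_mul_right _ _)
  · have e : (b : ℤ) * n * ν * nb + n * Q * u + a * b * Q * v - a =
        (b * n * ν * nb - a) + Q * (n * u + a * b * v) := by ring
    rw [e]; exact dvd_add dQ (dvd_mul_right _ _)

/-- **stub_gaussCoordinateSplit** (T0 of line `Sketch`): for `Q = a² + b²`, `0 < b`, `0 < n`,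
`gcd(b, a·n) = 1`, `gcd(n, Q) = 1`, with `ν := a·b⁻¹ (mod Q)`, `n̄ := n⁻¹ (mod Q)`,
`u := (a n)⁻¹ (mod b)`, `v := (b Q)⁻¹ (mod n)` (least non-negative residues):
`e(h ν n̄ / Q) = e(−h u / b) · e(−h a v / n) · e(h a / (b n Q))`, with `e(r) = exp(2π i r)`
written out. [folklore] -/
theorem stub_gaussCoordinateSplit :
    ∀ (a : ℤ) (b Q n : ℕ) (h : ℤ), 0 < b → 0 < n → (Q : ℤ) = a ^ 2 + (b : ℤ) ^ 2 →
      Int.gcd (b : ℤ) (a * n) = 1 → Nat.Coprime n Q →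
        Complex.exp (2 * Real.pi * Complex.I *
            (((h * ((((a : ZMod Q) * ((b : ZMod Q))⁻¹).val : ℕ) : ℤ) * ((((n : ZMod Q))⁻¹.val : ℕ) : ℤ) : ℤ) : ℝ) /
              (Q : ℝ) : ℝ)) =
          Complex.exp (2 * Real.pi * Complex.I *
              ((-((h * (((((a * n : ℤ) : ZMod b))⁻¹.val : ℕ) : ℤ) : ℤ) : ℝ)) / (b : ℝ) : ℝ)) *
            Complex.exp (2 * Real.pi * Complex.I *
              ((-((h * a * (((((b * Q : ℕ) : ZMod n))⁻¹.val : ℕ) : ℤ) : ℤ) : ℝ)) / (n : ℝ) : ℝ)) *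
            Complex.exp (2 * Real.pi * Complex.I * ((((h * a : ℤ) : ℝ) / ((b : ℝ) * n * Q) : ℝ) : ℂ)) := by
  intro a b Q n h hb hn hQ hcop hnQ
  have hW := gaussSplit_dvd a b Q n hb hn hQ hcop hnQ
  have hQpos : (0 : ℝ) < Q := by
    have : (0 : ℤ) < Q := by rw [hQ]; have := hb; positivity
    exact_mod_cast this
  have hbR : (b : ℝ) ≠ 0 := by positivity
  have hnR : (n : ℝ) ≠ 0 := by positivity
  have hQR : (Q : ℝ) ≠ 0 := hQpos.ne'
  generalize ((((a : ZMod Q) * ((b : ZMod Q))⁻¹).val : ℕ) : ℤ) = ν at hW ⊢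
  generalize ((((n : ZMod Q))⁻¹.val : ℕ) : ℤ) = nb at hW ⊢
  generalize (((((a * n : ℤ) : ZMod b))⁻¹.val : ℕ) : ℤ) = u at hW ⊢
  generalize (((((b * Q : ℕ) : ZMod n))⁻¹.val : ℕ) : ℤ) = v at hW ⊢
  obtain ⟨k, hk⟩ := hW
  have hkR : ((b : ℝ) * n * ν * nb + n * Q * u + a * b * Q * v - a : ℝ) = (b : ℝ) * n * Q * k := by
    exact_mod_cast hk
  have key : ((h * ν * nb : ℤ) : ℝ) / (Q : ℝ) =
      (-((h * u : ℤ) : ℝ)) / (b : ℝ) + (-((h * a * v : ℤ) : ℝ)) / (n : ℝ) +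
        ((h * a : ℤ) : ℝ) / ((b : ℝ) * n * Q) + ((h * k : ℤ) : ℝ) := by
    rw [div_add_div _ _ hbR hnR, div_add_div _ _ (mul_ne_zero hbR hnR) (by positivity),
      div_add' _ _ _ (by positivity), div_eq_div_iff hQR (by positivity)]
    push_cast
    linear_combination ((h : ℝ) * ((b : ℝ) * n) * (Q : ℝ)) * hkR
  rw [← Complex.exp_add, ← Complex.exp_add, Complex.exp_eq_exp_iff_exists_int]
  refine ⟨h * k, ?_⟩
  rw [key]
  push_cast
  ring

end Summit.Parity.BatemanHorn.Cruxes.SplitBlockJacobiCorner.Sketch
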